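/-
Soloist `solo-ValiantsHypothesis-informed`, session 19 — the finite core of the width budget.
-/
import Mathlib

/-!
# The width budget: Mirsky's theorem, the path budget and the dyadic class bounds

This file kernel-checks the finite-combinatorial core of the WIDTH BUDGET of the soloist note
`paper/quadspan.md` §7.10 (Lemma 7.47, Theorem 7.48; `work/s17/dd.md` Lemma 9.1 / Theorem 9.2).

Setting of the note (not formalised here): the flag tree of a rank-3 family over `ℂ[[z]]` whose
column reductions are pairwise distinct; every node `N` carries `g_N` children classes
(`∑_N g_N ≤ 2a`), an alive set of columns of size `D_N`, and `d_N ≤ D_N` BRANCHING columns.  The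
geometric inputs are

* the LOSS LEMMA along an edge `N → y`: `D_y ≤ D_N − d_N + (g_N − 1)` (non-branching alive columns are
  partitioned among the children; by transversality of digit lines at most `g_N − 1` branching
  columns survive into one child), whose telescoped form is the PATH BUDGET
  `∑_{N ∈ π} d_N ≤ b + ∑_{N ∈ π} (g_N − 1) ≤ n − 1` along every root path `π`;
* the ANTICHAIN COUNT (pair packing, landed as `soloInformed_antichainCount`): an antichain of nodes
  all with `≥ D` alive columns has `|𝒜| · C(D,2) ≤ C(b,2)`;
* the CHILDREN BUDGET `d_N ≤ C(g_N, 2)` (branching columns are distinct lines through `≥ 2` children).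

What is proved here, for an ARBITRARY finite partial order (in the application: the tree order, in
which every chain lies on a root path) and arbitrary weight functions:

* `soloInformed_mirsky` : Mirsky's theorem (dual Dilworth) in finset form — chains `≤ h` and
  antichains `≤ w` inside `S` force `|S| ≤ h · w`;
* `soloInformed_pathBudget` : the telescoping of the loss lemma along a path;
* `soloInformed_classBound_chains` : path budget + antichain count + Mirsky give
  `#{N : d_N ≥ D} · D · C(D,2) ≤ (n − 1) · C(b,2)`   (i.e. `|𝒮_D| ≲ (n/D) · (b²/D²)`);
* `soloInformed_classBound_children` : the children budget gives `|S| · (⌊√(2D)⌋ + 1) ≤ ∑_{S} g_N`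
  (i.e. `|𝒮_D| ≲ 2a/√(2D)`);
* `soloInformed_widthBudget_class` : the two bounds for the dyadic class
  `𝒮_D = {N : D ≤ d_N < 2D}` in the form used by Theorem 7.48:
  `(∑_{𝒮_D} d_N) · C(D,2) ≤ 2 (n−1) C(b,2)` and `(∑_{𝒮_D} d_N) · (⌊√(2D)⌋+1) ≤ 2D · 2a`.

Summing `min` of the two class bounds over `D = 2^i` (split at `D* = n^{4/5}`) is the elementary
arithmetic giving `∑_N d_N ≤ a + 16 n^{7/5} + 2 n log₂ n` in the note; it is not repeated here.
-/

namespace Summit.ValiantsHypothesis.ValiantsHypothesis.Theorems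

open Finset

section Mirsky

variable {ι : Type*} [PartialOrder ι]

/-- **Mirsky's theorem** (dual Dilworth), finset form: if every chain contained in `S` has at most
`h` elements and every antichain contained in `S` has at most `w` elements, then `|S| ≤ h · w`.
Proof: peel off the antichain of maximal elements; the remaining chains are shorter by one. -/
theorem soloInformed_mirsky (w : ℕ) :
    ∀ (h : ℕ) (S : Finset ι),
      (∀ C ⊆ S, IsChain (· ≤ ·) (C : Set ι) → C.card ≤ h) →
      (∀ A ⊆ S, IsAntichain (· ≤ ·) (A : Set ι) → A.card ≤ w) →
      S.card ≤ h * w := by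
  classical
  intro h
  induction h with
  | zero =>
    intro S hC _
    have hSe : S = ∅ := by
      rw [Finset.eq_empty_iff_forall_notMem]
      intro x hx
      have h1 := hC {x} (Finset.singleton_subset_iff.mpr hx) (by
        rw [Finset.coe_singleton]
        exact Set.subsingleton_singleton.isChain)
      simp at h1
    simp [hSe]
  | succ h ih =>
    intro S hC hA
    -- `M` = the maximal elements of `S`
    set M : Finset ι := S.filter (fun x => ∀ y ∈ S, ¬ x < y) with hM
    have hMsub : M ⊆ S := Finset.filter_subset _ _
    have hManti : IsAntichain (· ≤ ·) (M : Set ι) := by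
      intro x hx y hy hxy hle
      have hx' := (Finset.mem_filter.mp (Finset.mem_coe.mp hx)).2
      have hyS := (Finset.mem_filter.mp (Finset.mem_coe.mp hy)).1
      exact hx' y hyS (lt_of_le_of_ne hle hxy)
    have hMcard : M.card ≤ w := hA M hMsub hManti
    -- chains inside `S \ M` have at most `h` elements: extend by an element of `S` above the top
    have hC' : ∀ C ⊆ S \ M, IsChain (· ≤ ·) (C : Set ι) → C.card ≤ h := by
      intro C hCsub hCchain
      rcases C.eq_empty_or_nonempty with hCe | hCne
      · simp [hCe]
      · obtain ⟨x, hxmax⟩ := C.exists_maximal hCne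
        have hxC : x ∈ C := hxmax.1
        have hxtop : ∀ c ∈ C, c ≤ x := by
          intro c hc
          rcases eq_or_ne c x with hcx | hcx
          · exact hcx.le
          · rcases hCchain (Finset.mem_coe.mpr hc) (Finset.mem_coe.mpr hxC) hcx with hle | hle
            · exact hle
            · exact hxmax.2 hc hle
        have hxSM := Finset.mem_sdiff.mp (hCsub hxC)
        have hex : ∃ y ∈ S, x < y := by
          by_contra hcon
          exact hxSM.2 (Finset.mem_filter.mpr ⟨hxSM.1, fun y hy hxy => hcon ⟨y, hy, hxy⟩⟩)
        obtain ⟨y, hyS, hxy⟩ := hex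
        have hyC : y ∉ C := fun hyC => (lt_irrefl x) (lt_of_lt_of_le hxy (hxtop y hyC))
        have hins : IsChain (· ≤ ·) ((insert y C : Finset ι) : Set ι) := by
          rw [Finset.coe_insert]
          exact hCchain.insert (fun c hc _ => Or.inr ((hxtop c hc).trans hxy.le))
        have hsub : insert y C ⊆ S := by
          intro z hz
          rcases Finset.mem_insert.mp hz with hzy | hz
          · rw [hzy]; exact hyS
          · exact (Finset.mem_sdiff.mp (hCsub hz)).1
        have hcard := hC (insert y C) hsub hins
        rw [Finset.card_insert_of_notMem hyC] at hcard
        omega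
    have hA' : ∀ A ⊆ S \ M, IsAntichain (· ≤ ·) (A : Set ι) → A.card ≤ w :=
      fun A hAsub hAanti => hA A (hAsub.trans Finset.sdiff_subset) hAanti
    have hrec := ih (S \ M) hC' hA'
    have hsplit : (S \ M).card + M.card = S.card := Finset.card_sdiff_add_card_eq_card hMsub
    calc S.card = (S \ M).card + M.card := hsplit.symm
      _ ≤ h * w + w := Nat.add_le_add hrec hMcard
      _ = (h + 1) * w := by ring

end Mirsky

section PathBudget

/-- **Path budget** (the loss lemma telescoped along a root path `N₀, …, N_t`): if
`D (i+1) + d i ≤ D i + (g i − 1)` for `i < t` and `d t ≤ D t`, then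
`∑_{i ≤ t} d i ≤ D 0 + ∑_{i < t} (g i − 1)`.  In the note `D 0 = b` and `∑ (g − 1) ≤ a − 1`, so every
root path carries at most `n − 1` branching incidences. -/
theorem soloInformed_pathBudget (D d g : ℕ → ℕ) (t : ℕ)
    (hloss : ∀ i < t, D (i + 1) + d i ≤ D i + (g i - 1)) (hlast : d t ≤ D t) :
    ∑ i ∈ Finset.range (t + 1), d i ≤ D 0 + ∑ i ∈ Finset.range t, (g i - 1) := by
  have key : ∀ k ≤ t,
      ∑ i ∈ Finset.range k, d i + D k ≤ D 0 + ∑ i ∈ Finset.range k, (g i - 1) := by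
    intro k
    induction k with
    | zero => intro _; simp
    | succ k ihk =>
      intro hk
      have hk' : k < t := Nat.lt_of_succ_le hk
      have h1 := ihk hk'.le
      have h2 := hloss k hk'
      rw [Finset.sum_range_succ, Finset.sum_range_succ]
      omega
  have hkey := key t le_rfl
  rw [Finset.sum_range_succ]
  omega

end PathBudget

section ClassBounds

variable {ι : Type*}

/-- **Class bound from the children budget.**  If `D ≤ C(g N, 2)` for every `N ∈ S` then
`g N > √(2D)`, hence `|S| · (⌊√(2D)⌋ + 1) ≤ ∑_{N ∈ S} g N`. -/
theorem soloInformed_classBound_children (S : Finset ι) (g : ι → ℕ) (D : ℕ) (hD : 1 ≤ D)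
    (hg : ∀ N ∈ S, D ≤ (g N).choose 2) :
    S.card * (Nat.sqrt (2 * D) + 1) ≤ ∑ N ∈ S, g N := by
  calc S.card * (Nat.sqrt (2 * D) + 1) = ∑ _N ∈ S, (Nat.sqrt (2 * D) + 1) := by
        rw [Finset.sum_const, smul_eq_mul]
    _ ≤ ∑ N ∈ S, g N := Finset.sum_le_sum (fun N hN => by
        have h1 : D ≤ (g N).choose 2 := hg N hN
        rw [Nat.choose_two_right] at h1
        have h2 : D * 2 ≤ g N * (g N - 1) := (Nat.le_div_iff_mul_le Nat.zero_lt_two).mp h1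
        have hg0 : g N ≠ 0 := by
          intro h0
          rw [h0] at h2
          simp at h2
          omega
        obtain ⟨m, hm⟩ := Nat.exists_eq_succ_of_ne_zero hg0
        have h3 : 2 * D < g N * g N := by
          rw [hm] at h2 ⊢
          have : (m.succ) * (m.succ) = m.succ * (m.succ - 1) + m.succ := by
            simp [Nat.succ_eq_add_one]; ring
          omega
        exact Nat.succ_le_of_lt (Nat.sqrt_lt.mpr h3))

variable [PartialOrder ι] [Fintype ι]

/-- **Class bound from the path budget and the antichain count.**  If every chain carries total
weight `∑ d ≤ n − 1` and every antichain of nodes all with `d ≥ D` satisfies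
`|𝒜| · C(D,2) ≤ C(b,2)`, then by Mirsky `#{N : d N ≥ D} · D · C(D,2) ≤ (n − 1) · C(b,2)`. -/
theorem soloInformed_classBound_chains (d : ι → ℕ) (n b D : ℕ)
    (hchain : ∀ C : Finset ι, IsChain (· ≤ ·) (C : Set ι) → ∑ N ∈ C, d N ≤ n - 1)
    (hanti : ∀ A : Finset ι, IsAntichain (· ≤ ·) (A : Set ι) → (∀ N ∈ A, D ≤ d N) →
      A.card * D.choose 2 ≤ b.choose 2) :
    (Finset.univ.filter (fun N => D ≤ d N)).card * (D * D.choose 2) ≤ (n - 1) * b.choose 2 := by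
  classical
  set S := Finset.univ.filter (fun N => D ≤ d N) with hS
  rcases Nat.eq_zero_or_pos (D.choose 2) with h0 | hpos
  · simp [h0]
  have hDpos : 0 < D := by
    rcases Nat.eq_zero_or_pos D with hD0 | hD0
    · rw [hD0] at hpos; simp at hpos
    · exact hD0
  have hC : ∀ C ⊆ S, IsChain (· ≤ ·) (C : Set ι) → C.card ≤ (n - 1) / D := by
    intro C hCS hCc
    rw [Nat.le_div_iff_mul_le hDpos]
    calc C.card * D = ∑ _N ∈ C, D := by rw [Finset.sum_const, smul_eq_mul]
      _ ≤ ∑ N ∈ C, d N := Finset.sum_le_sum (fun N hN => (Finset.mem_filter.mp (hCS hN)).2)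
      _ ≤ n - 1 := hchain C hCc
  have hA : ∀ A ⊆ S, IsAntichain (· ≤ ·) (A : Set ι) → A.card ≤ b.choose 2 / D.choose 2 := by
    intro A hAS hAa
    rw [Nat.le_div_iff_mul_le hpos]
    exact hanti A hAa (fun N hN => (Finset.mem_filter.mp (hAS hN)).2)
  have hM := soloInformed_mirsky (b.choose 2 / D.choose 2) ((n - 1) / D) S hC hA
  calc S.card * (D * D.choose 2)
      ≤ ((n - 1) / D * (b.choose 2 / D.choose 2)) * (D * D.choose 2) :=
        Nat.mul_le_mul_right _ hM
    _ = ((n - 1) / D * D) * (b.choose 2 / D.choose 2 * D.choose 2) := by ring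
    _ ≤ (n - 1) * b.choose 2 :=
        Nat.mul_le_mul (Nat.div_mul_le_self _ _) (Nat.div_mul_le_self _ _)

/-- **Width budget, per dyadic class** (the two inequalities of Theorem 7.48 for
`𝒮_D = {N : D ≤ d_N < 2D}`): with the path budget, the antichain count, the children budget
`d_N ≤ C(g_N,2)` and `∑_N g_N ≤ 2a`,
`(∑_{𝒮_D} d_N) · C(D,2) ≤ 2 (n−1) C(b,2)` and `(∑_{𝒮_D} d_N) · (⌊√(2D)⌋ + 1) ≤ 2D · 2a`. -/
theorem soloInformed_widthBudget_class (d g : ι → ℕ) (n a b D : ℕ) (hD : 1 ≤ D)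
    (hchain : ∀ C : Finset ι, IsChain (· ≤ ·) (C : Set ι) → ∑ N ∈ C, d N ≤ n - 1)
    (hanti : ∀ A : Finset ι, IsAntichain (· ≤ ·) (A : Set ι) → (∀ N ∈ A, D ≤ d N) →
      A.card * D.choose 2 ≤ b.choose 2)
    (hdg : ∀ N, d N ≤ (g N).choose 2) (hsum : ∑ N, g N ≤ 2 * a) :
    (∑ N ∈ Finset.univ.filter (fun N => D ≤ d N ∧ d N < 2 * D), d N) * D.choose 2
        ≤ 2 * ((n - 1) * b.choose 2) ∧
    (∑ N ∈ Finset.univ.filter (fun N => D ≤ d N ∧ d N < 2 * D), d N) * (Nat.sqrt (2 * D) + 1)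
        ≤ 2 * D * (2 * a) := by
  classical
  set T := Finset.univ.filter (fun N => D ≤ d N ∧ d N < 2 * D) with hT
  -- `∑_T d ≤ 2D |T|`
  have hsumT : ∑ N ∈ T, d N ≤ T.card * (2 * D) := by
    calc ∑ N ∈ T, d N ≤ ∑ _N ∈ T, 2 * D :=
          Finset.sum_le_sum (fun N hN => ((Finset.mem_filter.mp hN).2.2).le)
      _ = T.card * (2 * D) := by rw [Finset.sum_const, smul_eq_mul]
  -- `T ⊆ S = {d ≥ D}`
  have hTS : T ⊆ Finset.univ.filter (fun N => D ≤ d N) := by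
    intro N hN
    exact Finset.mem_filter.mpr ⟨Finset.mem_univ _, (Finset.mem_filter.mp hN).2.1⟩
  have hTcard : T.card ≤ (Finset.univ.filter (fun N => D ≤ d N)).card := Finset.card_le_card hTS
  have h1 := soloInformed_classBound_chains d n b D hchain hanti
  have h2 := soloInformed_classBound_children T g D hD
    (fun N hN => ((Finset.mem_filter.mp hN).2.1).trans (hdg N))
  have h3 : ∑ N ∈ T, g N ≤ 2 * a :=
    (Finset.sum_le_sum_of_subset_of_nonneg (Finset.subset_univ T) (fun _ _ _ => Nat.zero_le _)).trans
      hsum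
  refine ⟨?_, ?_⟩
  · calc (∑ N ∈ T, d N) * D.choose 2 ≤ T.card * (2 * D) * D.choose 2 :=
          Nat.mul_le_mul_right _ hsumT
      _ = 2 * (T.card * (D * D.choose 2)) := by ring
      _ ≤ 2 * ((Finset.univ.filter (fun N => D ≤ d N)).card * (D * D.choose 2)) :=
          Nat.mul_le_mul_left _ (Nat.mul_le_mul_right _ hTcard)
      _ ≤ 2 * ((n - 1) * b.choose 2) := Nat.mul_le_mul_left _ h1
  · calc (∑ N ∈ T, d N) * (Nat.sqrt (2 * D) + 1) ≤ T.card * (2 * D) * (Nat.sqrt (2 * D) + 1) :=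
          Nat.mul_le_mul_right _ hsumT
      _ = 2 * D * (T.card * (Nat.sqrt (2 * D) + 1)) := by ring
      _ ≤ 2 * D * (∑ N ∈ T, g N) := Nat.mul_le_mul_left _ h2
      _ ≤ 2 * D * (2 * a) := Nat.mul_le_mul_left _ h3

end ClassBounds

end Summit.ValiantsHypothesis.ValiantsHypothesis.Theorems
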